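import Literature.Computability.QuantumComplexity.CWrapLayout
import Literature.Computability.QuantumComplexity.RevUncomputeUniform
import HarnessLib

/-!
# Classical wrapping inside quantum search: the layout sizes as counter expressions

Trunk `CryptoQuantFine`; bookkeeping for the uniformity of the wrapped family
(`CWrapLayout.lean`): every size of the layout, as a function of the family index `u`
(variable `uu` of the generator language of `RevTableauUniform.lean`), is the value of an
explicit counter expression (`GExpr GV`: constants, variables, sums, products) —
`CWrap.LhE`, `widthHE`, `PwE`, `baseBE`, `DE`, `nGE`, and the wire maps `empE`, `tWhE`,
`flagWE`, `blockWE` — with `eval` lemmas and the side condition `InUU` (only `uu` occurs)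
asked by `CleanBlockDesc.lean` and `RevMultiplexGen.lean`. Tableau expressions in the
tableau-length variable `xn` are moved to `uu` by substitution (`toUU`, `RevClean.substN`); the
polynomial ancilla bound `pF` is written as a Horner expression (`polyE`).
(Arora–Barak 2009, §6.2, proof of Thm. 6.15: sizes written with counters.)

## References

* S. Arora, B. Barak, *Computational Complexity: A Modern Approach*, CUP 2009, §6.2, Thm. 6.15.
-/

noncomputable section

namespace Literature.Computability.QuantumComplexity

namespace CWrap

open _root_.Computability Polynomial Complexity RevDesc RevSim RevClean Complexity.GExpr

/-! ### Moving tableau expressions to the family index; Horner expressions -/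

/-- Substitute the family index `uu` for the tableau length `xn`. [folklore] -/
def toUU (E : GE) : GE := E.subst (substN (.var .uu))

/-- Value of `toUU`. [folklore] -/
@[simp] theorem eval_toUU (E : GE) (env : GV → ℕ) : (toUU E).eval env = E.eval (Function.update env .xn (env .uu)) := by
  rw [toUU, GExpr.eval_subst, eval_substN]
  rfl

/-- The variables of a substituted expression come from the substituted variables. [folklore] -/
theorem fv_subst_sub (σ : GV → GE) : ∀ (E : GE), ∀ x ∈ (E.subst σ).fv, ∃ y ∈ E.fv, x ∈ (σ y).fv
  | .const _, x, hx => by simp [GExpr.subst, GExpr.fv] at hx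
  | .var y, x, hx => ⟨y, by simp [GExpr.fv], hx⟩
  | .add a b, x, hx => by
    simp only [GExpr.subst, GExpr.fv, List.mem_append] at hx
    rcases hx with hx | hx
    · obtain ⟨y, hy, h⟩ := fv_subst_sub σ a x hx; exact ⟨y, by simp [GExpr.fv, hy], h⟩
    · obtain ⟨y, hy, h⟩ := fv_subst_sub σ b x hx; exact ⟨y, by simp [GExpr.fv, hy], h⟩
  | .mul a b, x, hx => by
    simp only [GExpr.subst, GExpr.fv, List.mem_append] at hx
    rcases hx with hx | hx
    · obtain ⟨y, hy, h⟩ := fv_subst_sub σ a x hx; exact ⟨y, by simp [GExpr.fv, hy], h⟩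
    · obtain ⟨y, hy, h⟩ := fv_subst_sub σ b x hx; exact ⟨y, by simp [GExpr.fv, hy], h⟩

/-- An expression in `xn` only becomes an expression in `uu` only. [folklore] -/
theorem inUU_toUU {E : GE} (h : ∀ x ∈ E.fv, x = GV.xn) : InUU (toUU E) := by
  intro x hx
  obtain ⟨y, hy, hxy⟩ := fv_subst_sub _ E x hx
  have := h y hy; subst this
  simpa [substN, GExpr.fv] using hxy

/-- The Horner expression of a coefficient list at `e`. [folklore] -/
def hornerE (cs : List ℕ) (e : GE) : GE := cs.foldr (fun c acc => .add (.const c) (.mul e acc)) (.const 0)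

/-- Value of `hornerE`. [folklore] -/
theorem eval_hornerE (cs : List ℕ) (e : GE) (env : GV → ℕ) :
    (hornerE cs e).eval env = cs.foldr (fun c acc => c + e.eval env * acc) 0 := by
  induction cs with
  | nil => rfl
  | cons c cs ih => simp only [hornerE, List.foldr_cons, GExpr.eval] at ih ⊢; rw [ih]

/-- Variables of `hornerE`. [folklore] -/
theorem fv_hornerE_sub (cs : List ℕ) (e : GE) : ∀ x ∈ (hornerE cs e).fv, x ∈ e.fv := by
  induction cs with
  | nil => intro x hx; simp [hornerE, GExpr.fv] at hx
  | cons c cs ih =>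
    intro x hx
    simp only [hornerE, List.foldr_cons, GExpr.fv, List.nil_append, List.mem_append] at hx ih
    rcases hx with hx | hx
    · exact hx
    · exact ih x hx

/-- Horner evaluation of the coefficient list of a polynomial. [folklore] -/
theorem foldr_coeff_eq_eval (p : Polynomial ℕ) (v : ℕ) :
    ((List.range (p.natDegree + 1)).map p.coeff).foldr (fun c acc => c + v * acc) 0 = p.eval v := by
  have key : ∀ (m k : ℕ), ((List.range' k m).map p.coeff).foldr (fun c acc => c + v * acc) 0 =
      ∑ i ∈ Finset.range m, p.coeff (k + i) * v ^ i := by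
    intro m
    induction m with
    | zero => intro k; simp
    | succ m ih =>
      intro k
      rw [List.range'_succ, List.map_cons, List.foldr_cons, ih (k + 1), Finset.sum_range_succ', Finset.mul_sum]
      simp only [Nat.add_zero, pow_zero, mul_one]
      rw [add_comm]
      congr 1
      refine Finset.sum_congr rfl fun i _ => ?_
      rw [show k + 1 + i = k + (i + 1) by omega, pow_succ]; ring
  rw [List.range_eq_range', key]
  simp only [Nat.zero_add]
  rw [Polynomial.eval_eq_sum_range]

/-- The polynomial `p` at the expression `e`. [folklore] -/
def polyE (p : Polynomial ℕ) (e : GE) : GE := hornerE ((List.range (p.natDegree + 1)).map p.coeff) e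

/-- Value of `polyE`. [folklore] -/
@[simp] theorem eval_polyE (p : Polynomial ℕ) (e : GE) (env : GV → ℕ) : (polyE p e).eval env = p.eval (e.eval env) := by
  rw [polyE, eval_hornerE, foldr_coeff_eq_eval]

/-- Variables of `polyE`. [folklore] -/
theorem fv_polyE_sub (p : Polynomial ℕ) (e : GE) : ∀ x ∈ (polyE p e).fv, x ∈ e.fv := fv_hornerE_sub _ e

/-! ### The sizes -/

variable (Q : Layout)

/-- `L(u)` (`= Sn(u) + (dd - 1)`). [folklore] -/
def LhE : GE := .add (toUU (SnE Q.Mh.tm Q.eh)) (.const (dd Q.Mh.tm - 1))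

/-- `widthH(u) = NN(u) + JJ(u) · A₁`. [folklore] -/
def widthHE : GE := toUU (.add (.add (.var .xn) (ancNE Q.Mh.tm Q.eh)) (.mul (JJE Q.eh Q.Mh) (.const (A₁ Q.Mh))))

/-- `Pw(u)`. [folklore] -/
def PwE : GE := .add (LhE Q) (polyE Q.pF (LhE Q))

/-- `baseB(u)`. [folklore] -/
def baseBE : GE := .add (.add (widthHE Q) (.add (LhE Q) (.const 1))) (PwE Q)

/-- `D(u)`. [folklore] -/
def DE : GE := .add (baseBE Q) (.mul (.add (LhE Q) (.const 1)) (PwE Q))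

/-- `nG(u) = D(u) + 2u + 2`. [folklore] -/
def nGE : GE := .add (DE Q) (.add (.mul (.const 2) (.var .uu)) (.const 2))

/-- The emptiness wire of cell `j`. [folklore] -/
def empE (jE : GE) : GE :=
  .add (toUU (.add (.var .xn) (ancNE Q.Mh.tm Q.eh))) (.add (.mul jE (.const (A₁ Q.Mh))) (.const (eA Q.Mh none)))

/-- The `true`-code wire of cell `i`. [folklore] -/
def tWhE (iE : GE) : GE :=
  .add (toUU (.add (.var .xn) (ancNE Q.Mh.tm Q.eh))) (.add (.mul iE (.const (A₁ Q.Mh))) (.const (eA Q.Mh (symTrue Q.Mh))))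

/-- The flag wire of `ℓ`. [folklore] -/
def flagWE (ℓE : GE) : GE := .add (widthHE Q) ℓE

/-- Wire `i` of block `ℓ`. [folklore] -/
def blockWE (ℓE iE : GE) : GE := .add (.add (baseBE Q) (.mul ℓE (PwE Q))) iE

variable {Q}

/-- Value of `LhE`. [folklore] -/
@[simp] theorem eval_LhE (env : GV → ℕ) : (LhE Q).eval env = Lh Q (env .uu) := by
  have := one_le_dd Q.Mh.tm
  simp only [LhE, GExpr.eval, eval_toUU, eval_SnE, Function.update_self]
  unfold Lh JJ; omega

/-- Value of `widthHE`. [folklore] -/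
@[simp] theorem eval_widthHE (env : GV → ℕ) : (widthHE Q).eval env = widthH Q (env .uu) := by
  simp only [widthHE, eval_toUU, GExpr.eval, eval_ancNE, eval_JJE, Function.update_self]
  rfl

/-- Value of `PwE`. [folklore] -/
@[simp] theorem eval_PwE (env : GV → ℕ) : (PwE Q).eval env = Pw Q (env .uu) := by
  simp [PwE, GExpr.eval, Pw]

/-- Value of `baseBE`. [folklore] -/
@[simp] theorem eval_baseBE (env : GV → ℕ) : (baseBE Q).eval env = baseB Q (env .uu) := by
  simp [baseBE, GExpr.eval, baseB]

/-- Value of `DE`. [folklore] -/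
@[simp] theorem eval_DE (env : GV → ℕ) : (DE Q).eval env = D Q (env .uu) := by
  simp [DE, GExpr.eval, D]

/-- Value of `nGE`. [folklore] -/
@[simp] theorem eval_nGE (env : GV → ℕ) : (nGE Q).eval env = nG Q (env .uu) := by
  simp [nGE, GExpr.eval, nG]

/-- Value of `empE`. [folklore] -/
@[simp] theorem eval_empE (jE : GE) (env : GV → ℕ) : (empE Q jE).eval env = empW Q (env .uu) (jE.eval env) := by
  simp only [empE, GExpr.eval, eval_toUU, eval_ancNE, Function.update_self]
  rfl

/-- Value of `tWhE`. [folklore] -/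
@[simp] theorem eval_tWhE (iE : GE) (env : GV → ℕ) : (tWhE Q iE).eval env = tWh Q (env .uu) (iE.eval env) := by
  simp only [tWhE, GExpr.eval, eval_toUU, eval_ancNE, Function.update_self]
  rfl

/-- Value of `flagWE`. [folklore] -/
@[simp] theorem eval_flagWE (ℓE : GE) (env : GV → ℕ) : (flagWE Q ℓE).eval env = flagW Q (env .uu) (ℓE.eval env) := by
  simp [flagWE, GExpr.eval, flagW]

/-- Value of `blockWE`. [folklore] -/
@[simp] theorem eval_blockWE (ℓE iE : GE) (env : GV → ℕ) :
    (blockWE Q ℓE iE).eval env = blockW Q (env .uu) (ℓE.eval env) (iE.eval env) := by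
  simp [blockWE, GExpr.eval, blockW]

/-! ### Only the family index occurs -/

/-- Variables of a power. [folklore] -/
theorem fv_pw_sub (a : GE) : ∀ (m : ℕ), ∀ x ∈ (GE.pw a m).fv, x ∈ a.fv
  | 0, x, hx => by simp [GE.pw, GExpr.fv] at hx
  | m + 1, x, hx => by
    simp only [GE.pw, GExpr.fv, List.mem_append] at hx
    rcases hx with hx | hx
    · exact fv_pw_sub a m x hx
    · exact hx

/-- `TnE` mentions only `xn`. [folklore] -/
theorem fv_TnE (e : ℕ) : ∀ x ∈ (TnE e).fv, x = GV.xn := fun x hx => by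
  have h := fv_pw_sub _ e x hx
  simpa [GExpr.fv] using h

/-- `SnE` mentions only `xn`. [folklore] -/
theorem fv_SnE (tm : Turing.FinTM2) (e : ℕ) : ∀ x ∈ (SnE tm e).fv, x = GV.xn := fun x hx => by
  simp only [SnE, GExpr.fv, List.mem_append, List.mem_cons, List.not_mem_nil, or_false, List.nil_append] at hx
  rcases hx with rfl | hx
  · rfl
  · exact fv_TnE e x hx

/-- `LWE` mentions only `xn`. [folklore] -/
theorem fv_LWE (tm : Turing.FinTM2) (e : ℕ) : ∀ x ∈ (LWE tm e).fv, x = GV.xn := fun x hx => by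
  simp only [LWE, GExpr.fv, List.nil_append, List.append_nil] at hx
  exact fv_SnE tm e x hx

/-- `PPE` mentions only `xn`. [folklore] -/
theorem fv_PPE (tm : Turing.FinTM2) (e : ℕ) : ∀ x ∈ (PPE tm e).fv, x = GV.xn := fun x hx => by
  simp only [PPE, GExpr.fv, List.mem_append, List.not_mem_nil, or_false] at hx
  exact fv_LWE tm e x hx

/-- `ancNE` mentions only `xn`. [folklore] -/
theorem fv_ancNE (tm : Turing.FinTM2) (e : ℕ) : ∀ x ∈ (ancNE tm e).fv, x = GV.xn := fun x hx => by
  simp only [ancNE, GExpr.fv, List.mem_append, List.not_mem_nil, or_false] at hx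
  rcases hx with (hx | hx) | hx
  · exact fv_TnE e x hx
  · exact fv_PPE tm e x hx
  · exact fv_LWE tm e x hx

/-- `JJE` mentions only `xn`. [folklore] -/
theorem fv_JJE (e : ℕ) (M : Turing.TM2ComputableAux Bool Bool) : ∀ x ∈ (JJE e M).fv, x = GV.xn := fun x hx => by
  simp only [JJE, GExpr.fv, List.mem_append, List.not_mem_nil, or_false] at hx
  exact fv_SnE _ e x hx

/-- `LhE` mentions only `uu`. [folklore] -/
theorem inUU_LhE : InUU (LhE Q) := by
  intro x hx
  simp only [LhE, GExpr.fv, List.mem_append, List.not_mem_nil, or_false] at hx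
  exact inUU_toUU (fv_SnE _ _) x hx

/-- `widthHE` mentions only `uu`. [folklore] -/
theorem inUU_widthHE : InUU (widthHE Q) := by
  refine inUU_toUU fun x hx => ?_
  simp only [GExpr.fv, List.mem_append, List.mem_cons, List.not_mem_nil, or_false] at hx
  rcases hx with (rfl | hx) | hx
  · rfl
  · exact fv_ancNE _ _ x hx
  · exact fv_JJE _ _ x hx

/-- `PwE` mentions only `uu`. [folklore] -/
theorem inUU_PwE : InUU (PwE Q) := by
  intro x hx
  simp only [PwE, GExpr.fv, List.mem_append] at hx
  rcases hx with hx | hx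
  · exact inUU_LhE x hx
  · exact inUU_LhE x (fv_polyE_sub _ _ x hx)

/-- `baseBE` mentions only `uu`. [folklore] -/
theorem inUU_baseBE : InUU (baseBE Q) := by
  intro x hx
  simp only [baseBE, GExpr.fv, List.mem_append, List.not_mem_nil, or_false] at hx
  rcases hx with (hx | hx) | hx
  · exact inUU_widthHE x hx
  · exact inUU_LhE x hx
  · exact inUU_PwE x hx

/-- `DE` mentions only `uu`. [folklore] -/
theorem inUU_DE : InUU (DE Q) := by
  intro x hx
  simp only [DE, GExpr.fv, List.mem_append, List.not_mem_nil, or_false] at hx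
  rcases hx with hx | hx | hx
  · exact inUU_baseBE x hx
  · exact inUU_LhE x hx
  · exact inUU_PwE x hx

/-- `nGE` mentions only `uu`. [folklore] -/
theorem inUU_nGE : InUU (nGE Q) := by
  intro x hx
  simp only [nGE, GExpr.fv, List.mem_append, List.mem_cons, List.not_mem_nil, or_false, List.nil_append] at hx
  rcases hx with hx | rfl
  · exact inUU_DE x hx
  · rfl

end CWrap

end Literature.Computability.QuantumComplexity

end
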